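import Summits.HubbardSuperconductivity.HubbardSuperconductivity.Theorems.AnisotropyChordTransferFibre3L2Vars

/-!
# Route `AnisotropyChord` / H0 rotor rung, LEVEL 2 cell evaluator: the BLOCK PROPAGATORS as two-stage box variables

Design memo HOME/hubbard-h0-rotor-p2/LEVEL2-EVAL-DESIGN-g4.md, blueprint HOME/hubbard-h0-rotor-p2/level2_N1_hat.py (p2 g4).
The per-momentum block of every Level-2 row (PartN41-B §6 `blockP`/`block1`, `|q|∞ ≤ M₂ + 1`) needs the normalised propagators
`ĝ(q) := θ²·g(q) = θ²/(2ε(q) − νθ²)` as UNKNOWNS of the margin `RExpr` (indices ≥ 16 of the variable vector of `…Fibre3L2Vars`),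
boxed cell by cell.  THIS FILE supplies their boxes:
* `L2.ghatLoE q`, `L2.ghatHiE q : RExpr` — `1/(|q|² − ν)` and `1/(W_θ(q) − ν)`, `W_θ(q) = Σ_c q_c²(1 − θ² q_c²/12)`, as terms in the
  variables `x₀ = θ²`, `x₂ = ν` (so their enclosures on a cell box are kernel numbers);
* ★ `L2.ghat_bounds`: for `4K ≤ L`, `q ∈ zWindow K`, `ν < 4/π²`:
  `(ghatLoE q).eval (point L λ₂ a) ≤ θ²·gres L λ₂ (toTor q) ≤ (ghatHiE q).eval (point L λ₂ a)` (`B1.Xf_lower`, `B1.Xf_window` with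
  `θ₀ := θ`);
* ★ `L2.unknown_mem_of_encl` — the generic TWO-STAGE step: if `B.mem x`, `e₁.eval x ≤ u ≤ e₂.eval x` and the enclosures of `e₁, e₂`
  on `B` are `I₁, I₂`, then `I₁.fst ≤ u ≤ I₂.snd`; so the extended point (…, u, …) lies in the extended box (`Box.mem` of an appended
  coordinate: `mem_append_single`).
Prover seat `hubbard-h0-rotor-p2` g4; helper for piece A = stmt-HubbardSuperconductivity-23918 of rung 19089
(`--supports`, helper class).  Nothing here proves superconductivity in the Hubbard model; helper definitions/lemmas of ONE
conditional reduction (the GM₃ ∀L certificate, Level-2 rows); the rotor TARGET as originally worded stays FALSE (g15 verdict).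
Mathlib + the tree only; no sorry.
-/

set_option linter.dupNamespace false
set_option autoImplicit false

open scoped BigOperators
open Literature.Analysis.ValidatedNumerics

namespace Summit.HubbardSuperconductivity.HubbardSuperconductivity.Theorems.AnisotropyChord.Transfer.Fibre3.L2

/-! ## The two endpoint terms -/

/-- `1/(|q|² − ν)` as a term in `x₂ = ν`. -/
def ghatLoE (q : ℤ × ℤ) : RExpr :=
  .inv (.sub (.const ((q.1 ^ 2 + q.2 ^ 2 : ℤ) : ℚ)) (.var 2))

/-- `1/(W_θ(q) − ν)`, `W_θ(q) = q₁²(1 − θ²q₁²/12) + q₂²(1 − θ²q₂²/12)`, as a term in `x₀ = θ²`, `x₂ = ν`. -/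
def ghatHiE (q : ℤ × ℤ) : RExpr :=
  .inv (.sub
    (.add (.mul (.const ((q.1 ^ 2 : ℤ) : ℚ)) (.sub (.const 1) (.mul (.var 0) (.const (((q.1 ^ 2 : ℤ) : ℚ) / 12)))))
          (.mul (.const ((q.2 ^ 2 : ℤ) : ℚ)) (.sub (.const 1) (.mul (.var 0) (.const (((q.2 ^ 2 : ℤ) : ℚ) / 12))))))
    (.var 2))

/-! ## Their values at the true point bound the block propagators -/

noncomputable section

/-- the endpoint terms evaluated at the Level-2 point. [folklore] -/
theorem eval_ghatE (L : ℕ) [NeZero L] (lam2 a : ℝ) (q : ℤ × ℤ) :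
    (ghatLoE q).eval (point L lam2 a) = 1 / (B1.nsq q - lam2 / (2 * Real.pi / L) ^ 2) ∧
    (ghatHiE q).eval (point L lam2 a) = 1 / (B1.winE (2 * Real.pi / L) q - lam2 / (2 * Real.pi / L) ^ 2) := by
  constructor
  · simp only [ghatLoE, RExpr.eval, point]
    unfold B1.nsq
    push_cast
    rw [one_div]
  · simp only [ghatHiE, RExpr.eval, point]
    unfold B1.winE
    push_cast
    rw [one_div]
    congr 1
    ring

/-- ★ **BLOCK PROPAGATOR BOUNDS**: for `4K ≤ L`, `q ∈ zWindow K`, `ν = λ₂/θ² < 4/π²`: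
`(ghatLoE q).eval x ≤ θ²·g(q) ≤ (ghatHiE q).eval x` at `x = point L λ₂ a`. -/
theorem ghat_bounds (L : ℕ) [NeZero L] (lam2 a : ℝ) (K : ℕ) (h4K : 4 * K ≤ L) (q : ℤ × ℤ) (hq : q ∈ zWindow K)
    (hν : lam2 / (2 * Real.pi / L) ^ 2 < 4 / Real.pi ^ 2) :
    (ghatLoE q).eval (point L lam2 a) ≤ (2 * Real.pi / L) ^ 2 * gres L lam2 (B1.toTor L q) ∧
    (2 * Real.pi / L) ^ 2 * gres L lam2 (B1.toTor L q) ≤ (ghatHiE q).eval (point L lam2 a) := by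
  obtain ⟨elo, ehi⟩ := eval_ghatE L lam2 a q
  have hLpos : (0 : ℝ) < L := by exact_mod_cast Nat.pos_of_ne_zero (NeZero.ne L)
  have hθ2 : (2 * Real.pi / L) ^ 2 ≠ 0 := by positivity
  set ν : ℝ := lam2 / (2 * Real.pi / L) ^ 2 with hνdef
  have hlam : lam2 = ν * (2 * Real.pi / L) ^ 2 := by rw [hνdef, div_mul_cancel₀ _ hθ2]
  -- `θ²·g(q) = Xf ν q 0` (shift `q`, base momentum `0`)
  have hX : (2 * Real.pi / L) ^ 2 * gres L lam2 (B1.toTor L q) = B1.Xf L ν q 0 := by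
    unfold B1.Xf
    rw [zero_add, ← hlam]
  rw [elo, ehi, hX]
  have hθK := B1.theta_mul_le L K h4K
  constructor
  · exact B1.Xf_lower L ν hν K h4K q 0 q hq (by rw [zero_add])
  · exact B1.Xf_window L ν hν (2 * Real.pi / L) K le_rfl hθK q 0 q hq (by rw [zero_add])

/-! ## The generic two-stage step -/

/-- ★ **TWO-STAGE BOXING OF AN UNKNOWN**: an unknown real `u` squeezed between two terms whose enclosures on the box are known
lies in the numeric interval `[I₁.fst, I₂.snd]`. -/
theorem unknown_mem_of_encl {B : Box} {x : ℕ → ℝ} (hx : B.mem x) {e₁ e₂ : RExpr} {u : ℝ}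
    (h1 : e₁.eval x ≤ u) (h2 : u ≤ e₂.eval x) {prec iters : ℕ} {I₁ I₂ : NonemptyInterval ℚ}
    (hI₁ : e₁.enclose prec iters B.toIvl = some I₁) (hI₂ : e₂.enclose prec iters B.toIvl = some I₂) :
    ((I₁.fst : ℚ) : ℝ) ≤ u ∧ u ≤ ((I₂.snd : ℚ) : ℝ) := by
  have m1 := RExpr.eval_mem_enclose (fun i => Box.mem_toIvl hx i) e₁ hI₁
  have m2 := RExpr.eval_mem_enclose (fun i => Box.mem_toIvl hx i) e₂ hI₂
  rw [NonemptyInterval.mem_ratCast_iff] at m1 m2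
  exact ⟨m1.1.trans h1, h2.trans m2.2⟩

/-- appending one coordinate: if `x` lies in `B` on the first `B.length` coordinates and the new value lies in the new interval,
the updated point lies in `B ++ [I]`. [folklore] -/
theorem mem_append_single {B : Box} {x : ℕ → ℝ} (hx : B.mem x) (lo hi : ℚ) (u : ℝ)
    (hu : ((lo : ℚ) : ℝ) ≤ u ∧ u ≤ ((hi : ℚ) : ℝ)) (hzero : ∀ i, B.length < i → x i = 0) :
    (B ++ [(lo, hi)]).mem (Function.update x B.length u) := by
  intro i
  unfold Box.ivl
  by_cases hi1 : i < B.length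
  · have hne : i ≠ B.length := by omega
    rw [Function.update_of_ne hne, List.getD_eq_getElem?_getD, List.getElem?_append_left hi1,
      ← List.getD_eq_getElem?_getD]
    exact hx i
  · by_cases hi2 : i = B.length
    · subst hi2
      rw [Function.update_self, List.getD_eq_getElem?_getD, List.getElem?_append_right (le_refl _), Nat.sub_self]
      simpa using hu
    · have hgt : B.length < i := by omega
      have hne : i ≠ B.length := by omega
      rw [Function.update_of_ne hne, hzero i hgt, List.getD_eq_getElem?_getD,
        List.getElem?_append_right (by omega)]
      rw [List.getElem?_eq_none (by simp; omega)]
      simp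

end

end Summit.HubbardSuperconductivity.HubbardSuperconductivity.Theorems.AnisotropyChord.Transfer.Fibre3.L2
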